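import Literature.AlgebraicGeometry.HodgeTheory.BettiKunnethPieceCorrespondenceRepresentationRank
import Literature.AlgebraicGeometry.HodgeTheory.BettiNumbersEulerCharacteristic
import HarnessLib

/-!
# `HC(C × Z)` for a smooth projective curve times an `n`-fold iff the morphisms of Hodge structures `H¹(C) → Hʲ(Z)((j−1)/2)` (`j` odd) are accounted for by algebraic correspondences; `C × T` for a threefold:
# `HC(C × T) ⟺ dim_ℚ Hom_HS(H¹C, H³T(1)) ≤ dim_ℂ ⟨algebraic actions H³(T;ℂ) → H¹(C;ℂ)⟩`, unconditionally
# (Voisin I §11.3.3 Thm. 11.38–11.40, Lemma 11.41, p. 287; Voisin II (10.7); Voisin 2025 §3.2.1; Deligne 2000 §1)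

Family `hodge`, lane `lit-hodgefound` (Track 2 foundations library; Layers A1/A4), layer `Literature/AlgebraicGeometry/HodgeTheory`.  THEOREMS ONLY (no definition, no named fact, no instance;
D-0026 net debt `0`).  A smooth projective CURVE `C` is «off-middle algebraic» in the sense of the seat's g29/g30 files — `Hᵏ(C;ℚ) = 0` for `k ≥ 3`, `Hdgᵇ(H^{2b}C) = H^{2b}(C;ℚ)` for all `b` (points and the
fundamental class) — and `HC(C)` holds; so the LEFT criteria of g30-#3/#4 apply verbatim with `Y = C`, `m = 1`: `HC(C × Z)` (for `Z` an `n`-fold with `HC(Z)`) is decided on the pieces `H¹(C) ⊗ Hʲ(Z)`,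
`j` odd, and the piece `H¹(C) ⊗ H¹(Z)` is free (Lefschetz `(1,1)`).  By Lemma 11.41 the Hodge classes of `H¹(C) ⊗ Hʲ(Z)` (`j + 1 = 2c`) are the morphisms of Hodge structures `H¹(C) → Hʲ(Z)(c − 1)` — for
`j = 3` and a threefold `T`, the maps `H¹(C) → H³(T)(1)` underlying homomorphisms `J(C) → J²(T)` into the intermediate Jacobian — and the Hodge conjecture for `C × Z` says they are induced, in
action on `H^{2n−j}(Z;ℂ)`, by codimension-`c` cycles on `C × Z`.  Hence **`HC(C × T) ⟺ dim_ℚ Hom_HS(H¹C, H³T(1)) ≤ dim_ℂ ⟨(γ ⊗ 1)_* : H³(T;ℂ) → H¹(C;ℂ) | γ ∈ H⁴(C × T;ℚ), γ ⊗ 1 ∈ N²⟩`**,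
unconditionally (`HC(T)` is a theorem of the tree), and in general `HC(C × Z) ⟺` the numeric criterion on every piece `H¹(C) ⊗ Hʲ(Z)`, `j` odd, `3 ≤ j ≤ n`.

WHAT IS PROVED.
* §1 CURVES ARE OFF-MIDDLE ALGEBRAIC: **`BettiUniverse.finrank_bettiCohomology_curve_eq_zero_of_odd_of_ne_one`**, (**`BettiUniverse.hodgeClasses_hodge_eq_top_curve`** is the tree's), `HC(C)` (dimension `≤ 3`);
  **`BettiUniverse.kunneth_one_one_algebraic`** (the piece `H¹(Y) ⊗ H¹(Z)` of `H²` is free, Lefschetz `(1,1)`).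
* §2 **`BettiUniverse.hodgeConjectureFor_curve_tensor_iff_forall_exists_corrAction_eq`** (∃-form on the pieces `(1, j)`, `j` odd, `3 ≤ j ≤ n`), **`BettiUniverse.hodgeConjectureFor_curve_tensor_iff_forall_finrank_le`**
  (numeric form), for `Z` with `HC(Z)`.
* §3 **`BettiUniverse.hodgeConjectureFor_curve_tensor_threefold_iff_finrank_hom_le_finrank_span`** (`HC(C × T) ⟺ dim_ℚ Hom_HS(H¹C, H³T(1)) ≤ dim_ℂ AS`, unconditional equivalence),
  **`…_of_linearIndependent_corrAction`** (family form), **`…_iff_forall_exists_corrAction_eq`** (∃-form); **`BettiUniverse.hodgeConjectureFor_curve_tensor_fourfold_iff_finrank_hom_le_finrank_span`** (`C × X`,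
  `dim X = 4`, `HC(X)`: the single piece `H¹C ⊗ H³X ⊂ H⁴`, actions `H⁵(X;ℂ) → H¹(C;ℂ)`).

THE PRINTS.  C. Voisin (2002) [VoisinHodgeI2002] §11.1.2 Prop. 11.20; §11.3.1 Thm. 11.30; §11.3.3 Thm. 11.38–11.40, Lemma 11.41 and pp. 286–287; §12.1.2–12.1.3 (intermediate Jacobians, Abel–Jacobi).  C. Voisin (2003)
[VoisinHodgeII2003] §10.2.2 proof of Thm. 10.17, (10.7).  C. Voisin (2025) [Voisin2025] §3.2.1 (12)–(14), Prop. 3.8, Cor. 3.9.  P. Deligne (2000/2006) [Deligne2000] §1.  A. Hatcher (2002) [HatcherAT2002] §3.3 Thm. 3.26.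

THE OBJECTS (all the tree's).  `corrAction μ hC hZ hab`, `BettiUniverse.crossMap`, `BettiUniverse.kunnethSummand`, `BettiUniverse.hodge hHD hX k`, `hodgeClasses`, `HodgeStructure.Hom`, `tensor`, `tateTwist`, `cast`,
`bettiCohomology`, `complexBetti`, `ofRatClass`, `algebraicClasses`, `HodgeConjectureFor`.

DEVIATIONS / SCOPE.  Intermediate Jacobians and the Abel–Jacobi map are only the motivation of the reading; the statements are about `Hom_HS(H¹C, HʲZ(s))` and correspondence actions.  No definitions.

## References
* [VoisinHodgeI2002] C. Voisin, *Hodge Theory and Complex Algebraic Geometry I* (2002) — §11.1.2 Prop. 11.20; §11.3.1 Thm. 11.30; §11.3.3 Thm. 11.38, Thm. 11.40, Lemma 11.41, pp. 286–287; §12.1.2–12.1.3.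
* [VoisinHodgeII2003] C. Voisin, *Hodge Theory and Complex Algebraic Geometry II* (2003) — §10.2.2 proof of Thm. 10.17 (10.7).
* [Voisin2025] C. Voisin, *Cycle classes on algebraic varieties* (2025) — §3.2.1 (12)–(14), Prop. 3.8, Cor. 3.9.
* [Deligne2000] P. Deligne, *The Hodge conjecture* (Clay problem description) — §1.
* [HatcherAT2002] A. Hatcher, *Algebraic Topology* (2002) — §3.3 Thm. 3.26.

## Provenance
Lane `lit-hodgefound` (Hodge path, Track 2), prover seat `lit-hodgefound-p29` (generation 30), self-proposed row g30-#7 (g30-#3/#4 LEFT read with `Y` a curve).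
-/

noncomputable section

open scoped TensorProduct
open CategoryTheory MonoidalCategory CartesianMonoidalCategory Module Finset
open Literature.AlgebraicTopology.SingularHomology
open Literature.Geometry.Kaehler

namespace Literature.AlgebraicGeometry.HodgeTheory

open Literature.AlgebraicGeometry.Motives
open Literature.AlgebraicGeometry.Motives.HodgeStructure

variable {n d : ℕ} {C X Y Z T : SchemeOver ℂ}

/-! ### §1 Curves are off-middle algebraic -/

/-- **`b_k(C) = 0` for `k` odd, `k ≠ 1`**, `C` a smooth projective curve (`Hᵏ = 0` above the top degree `2`). [cite: HatcherAT2002, §3.3 Thm. 3.26] -/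
theorem BettiUniverse.finrank_bettiCohomology_curve_eq_zero_of_odd_of_ne_one (hC : IsSmoothProjective 1 C) (k : ℕ) (hk : Odd k) (hk1 : k ≠ 1) :
    Module.finrank ℚ (bettiCohomology C k) = 0 := by
  refine BettiUniverse.finrank_bettiCohomology_eq_zero_of_lt hC ?_
  obtain ⟨r, rfl⟩ := hk
  omega

/-- `2b ≠ 1` is no restriction: **`Hdgᵇ(H^{2b}(C)) = H^{2b}(C;ℚ)` for every `b`** (the tree's `hodgeClasses_hodge_eq_top_curve`, restated in the «off-middle» shape). [cite: VoisinHodgeI2002, §11.3.1 Thm. 11.30 and §7.1.2] -/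
theorem BettiUniverse.hodgeClasses_hodge_eq_top_curve_of_ne [HodgeTensorFacts.{0, 0}] (hHD : exists_isReal_hodgeModel) (hC : IsSmoothProjective 1 C) (b : ℕ) (_hb : 2 * b ≠ 1) :
    (BettiUniverse.hodge hHD hC (2 * b)).hodgeClasses b = ⊤ :=
  BettiUniverse.hodgeClasses_hodge_eq_top_curve hHD hC b

section Pieces

variable [HodgeTensorFacts.{0, 0}] (μ : OrientationFamily)

/-- **The piece `H¹(Y) ⊗ H¹(Z)` of `H²(Y × Z)` is free**: its Hodge classes are divisor classes of `Y × Z` (Lefschetz `(1,1)`; the tree's `…_of_lefschetzRange`). [cite: VoisinHodgeI2002, §11.3.1 Thm. 11.30 and §11.3.3 p. 287] -/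
theorem BettiUniverse.kunneth_one_one_algebraic {m : ℕ} (hHD : exists_isReal_hodgeModel) (hY : IsSmoothProjective m Y) (hZ : IsSmoothProjective n Z) :
    ∀ t ∈ (BettiUniverse.kunnethSummand hHD hY hZ (2 * 1) ⟨(1, 1), HasAntidiagonal.mem_antidiagonal.2 rfl⟩).hodgeClasses 1,
      ofRatClass (ComplexPoints (Y ⊗ Z)) (2 * 1) (BettiUniverse.crossMap Y Z (show 1 + 1 = 2 * 1 by norm_num) t) ∈ algebraicClasses (Y ⊗ Z) 1 :=
  fun _ ht ↦ BettiUniverse.ofRatClass_crossMap_mem_algebraicClasses_of_lefschetzRange hHD hY hZ (hY.tensor_holds hZ) _ (Or.inl le_rfl) ht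

/-! ### §2 `HC(C × Z)` on the pieces `H¹(C) ⊗ Hʲ(Z)`, `j` odd, `3 ≤ j ≤ dim Z` -/

/-- **`HC(C × Z)` IFF every Hodge class of every piece `H¹(C) ⊗ Hʲ(Z)`, `j` odd, `3 ≤ j ≤ n`, acts on `H^{2n−j}(Z;ℂ)` as some rational algebraic class of `H^{j+1}(C × Z)` does** (`C` a smooth projective curve, `Z` an
`n`-fold with `HC(Z)`; even `j` contribute nothing since `1 + j` must be even, and `j = 1` is the free piece of divisors). [cite: VoisinHodgeI2002, §11.3.3 Thm. 11.38–11.40, Lemma 11.41 and pp. 286–287, §11.3.1 Thm. 11.30]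
[cite: Voisin2025, §3.2.1 (12)–(14), Prop. 3.8 and Cor. 3.9] [cite: Deligne2000, §1] -/
theorem BettiUniverse.hodgeConjectureFor_curve_tensor_iff_forall_exists_corrAction_eq (hHD : exists_isReal_hodgeModel) (hC : IsSmoothProjective 1 C) (hZ : IsSmoothProjective n Z)
    (hCZ : IsSmoothProjective d (C ⊗ Z)) (hHCZ : HodgeConjectureFor n Z) :
    HodgeConjectureFor d (C ⊗ Z) ↔
      ∀ (c j a : ℕ) (hj : 1 + j = 2 * c) (hab : a + 2 * c = 1 + 2 * n), 3 ≤ j → j ≤ n →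
        ∀ t ∈ (BettiUniverse.kunnethSummand hHD hC hZ (2 * c) ⟨(1, j), HasAntidiagonal.mem_antidiagonal.2 hj⟩).hodgeClasses c,
          ∃ γ : bettiCohomology (C ⊗ Z) (2 * c), ofRatClass (ComplexPoints (C ⊗ Z)) (2 * c) γ ∈ algebraicClasses (C ⊗ Z) c ∧
            corrAction μ hC hZ hab (ofRatClass (ComplexPoints (C ⊗ Z)) (2 * c) γ) = corrAction μ hC hZ hab (ofRatClass (ComplexPoints (C ⊗ Z)) (2 * c) (BettiUniverse.crossMap C Z hj t)) := by
  have hHCC : HodgeConjectureFor 1 C := hodgeConjectureFor_of_dim_le_three_holds (by norm_num) hC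
  rw [BettiUniverse.hodgeConjectureFor_tensor_iff_forall_exists_corrAction_eq_left μ hHD hC hZ hCZ hHCC hHCZ (BettiUniverse.finrank_bettiCohomology_curve_eq_zero_of_odd_of_ne_one hC)
    (fun b hb ↦ BettiUniverse.hodgeClasses_hodge_eq_top_curve_of_ne hHD hC b hb)]
  refine ⟨fun h c j a hj hab hj3 hjn t ht ↦ h c j a hj hab (by omega) hjn t ht, fun h c j a hj hab hj1 hjn t ht ↦ ?_⟩
  by_cases hj3 : 3 ≤ j
  · exact h c j a hj hab hj3 hjn t ht
  · -- `j = 1`: the free piece `H¹(C) ⊗ H¹(Z)`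
    obtain rfl : j = 1 := by omega
    obtain rfl : c = 1 := by omega
    exact ⟨_, BettiUniverse.kunneth_one_one_algebraic hHD hC hZ t ht, rfl⟩

/-- **NUMERIC FORM: `HC(C × Z) ⟺` for every odd `j` with `3 ≤ j ≤ n`: `dim_ℚ Hdgᶜ(H¹C ⊗ HʲZ) ≤ dim_ℂ ⟨actions on H^{2n−j}(Z;ℂ) of the rational algebraic classes of H^{j+1}(C × Z)⟩`** (`2c = j + 1`; by Lemma 11.41
`dim_ℚ Hdgᶜ(H¹C ⊗ HʲZ) = dim_ℚ Hom_HS(H¹C, HʲZ(c − 1))`). [cite: VoisinHodgeI2002, §11.3.3 Thm. 11.38–11.40, Lemma 11.41 and pp. 286–287] [cite: Voisin2025, §3.2.1 (12)–(14), Prop. 3.8 and Cor. 3.9] [cite: Deligne2000, §1] -/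
theorem BettiUniverse.hodgeConjectureFor_curve_tensor_iff_forall_finrank_le (hHD : exists_isReal_hodgeModel) (hC : IsSmoothProjective 1 C) (hZ : IsSmoothProjective n Z)
    (hCZ : IsSmoothProjective d (C ⊗ Z)) (hHCZ : HodgeConjectureFor n Z) :
    HodgeConjectureFor d (C ⊗ Z) ↔
      ∀ (c j a : ℕ) (hj : 1 + j = 2 * c) (hab : a + 2 * c = 1 + 2 * n), 3 ≤ j → j ≤ n →
        Module.finrank ℚ ↥(((BettiUniverse.hodge hHD hC 1).tensor (BettiUniverse.hodge hHD hZ j)).hodgeClasses c) ≤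
          Module.finrank ℂ ↥(Submodule.span ℂ ((fun γ ↦ corrAction μ hC hZ hab (ofRatClass (ComplexPoints (C ⊗ Z)) (2 * c) γ)) ''
            {γ : bettiCohomology (C ⊗ Z) (2 * c) | ofRatClass (ComplexPoints (C ⊗ Z)) (2 * c) γ ∈ algebraicClasses (C ⊗ Z) c})) := by
  have hHCC : HodgeConjectureFor 1 C := hodgeConjectureFor_of_dim_le_three_holds (by norm_num) hC
  have hodd := BettiUniverse.finrank_bettiCohomology_curve_eq_zero_of_odd_of_ne_one hC
  have heven : ∀ b, 2 * b ≠ 1 → (BettiUniverse.hodge hHD hC (2 * b)).hodgeClasses b = ⊤ := fun b hb ↦ BettiUniverse.hodgeClasses_hodge_eq_top_curve_of_ne hHD hC b hb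
  rw [BettiUniverse.hodgeConjectureFor_tensor_iff_forall_finrank_le_left μ hHD hC hZ hCZ hHCC hHCZ hodd heven]
  refine ⟨fun h c j a hj hab hj3 hjn ↦ h c j a hj hab (by omega) hjn, fun h c j a hj hab hj1 hjn ↦ ?_⟩
  by_cases hj3 : 3 ≤ j
  · exact h c j a hj hab hj3 hjn
  · obtain rfl : j = 1 := by omega
    obtain rfl : c = 1 := by omega
    exact (BettiUniverse.kunneth_piece_algebraic_iff_finrank_le_left μ hHD hC hZ hHCC hHCZ hodd heven hj (by omega) hab).1 (BettiUniverse.kunneth_one_one_algebraic hHD hC hZ)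

/-! ### §3 A curve times a threefold, a curve times a fourfold -/

/-- **`HC(C × T) ⟺ dim_ℚ Hom_HS(H¹(C), H³(T)(1)) ≤ dim_ℂ ⟨(γ ⊗ 1)_* : H³(T;ℂ) → H¹(C;ℂ) | γ ∈ H⁴(C × T;ℚ), γ ⊗ 1 ∈ N²(C × T)⟩`** for a smooth projective curve `C` and threefold `T` — an UNCONDITIONAL equivalence
(`HC(T)` is a theorem in dimension `3`): the only piece to check is `H¹(C) ⊗ H³(T) ⊂ H⁴(C × T)`, whose Hodge classes are the morphisms `H¹(C) → H³(T)(1)` (those underlying `J(C) → J²(T)`), and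
`HC(C × T)` says that they are realised, in action, by codimension-`2` algebraic cycles on `C × T`. [cite: VoisinHodgeI2002, §11.3.3 Thm. 11.38–11.40, Lemma 11.41 and pp. 286–287, §12.1.2–12.1.3] [cite: Voisin2025, §3.2.1 (12)–(14), Prop. 3.8 and Cor. 3.9]
[cite: Deligne2000, §1] -/
theorem BettiUniverse.hodgeConjectureFor_curve_tensor_threefold_iff_finrank_hom_le_finrank_span (hHD : exists_isReal_hodgeModel) (hC : IsSmoothProjective 1 C) (hT : IsSmoothProjective 3 T)
    (hCT : IsSmoothProjective d (C ⊗ T)) :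
    HodgeConjectureFor d (C ⊗ T) ↔
      Module.finrank ℚ (HodgeStructure.Hom (BettiUniverse.hodge hHD hC 1) (((BettiUniverse.hodge hHD hT 3).tateTwist 1).cast (by norm_num))) ≤
        Module.finrank ℂ ↥(Submodule.span ℂ ((fun γ ↦ corrAction μ hC hT (rfl : 3 + 2 * 2 = 1 + 2 * 3) (ofRatClass (ComplexPoints (C ⊗ T)) (2 * 2) γ)) ''
          {γ : bettiCohomology (C ⊗ T) (2 * 2) | ofRatClass (ComplexPoints (C ⊗ T)) (2 * 2) γ ∈ algebraicClasses (C ⊗ T) 2})) := by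
  have hHCT : HodgeConjectureFor 3 T := hodgeConjectureFor_of_dim_le_three_holds le_rfl hT
  have e := BettiUniverse.finrank_hodgeClasses_tensor_hodge_eq_finrank_hom_tateTwist hHD hC hT 1 3 (s := 1) (by norm_num)
  rw [show (((1 : ℕ) : ℤ) + 1) = ((2 : ℕ) : ℤ) by norm_num] at e
  rw [← e, BettiUniverse.hodgeConjectureFor_curve_tensor_iff_forall_finrank_le μ hHD hC hT hCT hHCT]
  refine ⟨fun h ↦ h 2 3 3 (by norm_num) rfl le_rfl le_rfl, fun h c j a hj hab hj3 hjn ↦ ?_⟩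
  obtain rfl : j = 3 := by omega
  obtain rfl : c = 2 := by omega
  obtain rfl : a = 3 := by omega
  exact h

/-- **∃-form for `C × T`**: `HC(C × T)` iff every Hodge class of `H¹(C) ⊗ H³(T)` acts on `H³(T;ℂ)` as a rational algebraic class of `H⁴(C × T)` does. [cite: VoisinHodgeI2002, §11.3.3 Thm. 11.38–11.40, Lemma 11.41 and pp. 286–287]
[cite: Voisin2025, §3.2.1 (12)–(14), Prop. 3.8 and Cor. 3.9] [cite: Deligne2000, §1] -/
theorem BettiUniverse.hodgeConjectureFor_curve_tensor_threefold_iff_forall_exists_corrAction_eq (hHD : exists_isReal_hodgeModel) (hC : IsSmoothProjective 1 C) (hT : IsSmoothProjective 3 T)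
    (hCT : IsSmoothProjective d (C ⊗ T)) :
    HodgeConjectureFor d (C ⊗ T) ↔
      ∀ t ∈ (BettiUniverse.kunnethSummand hHD hC hT (2 * 2) ⟨(1, 3), HasAntidiagonal.mem_antidiagonal.2 rfl⟩).hodgeClasses 2,
        ∃ γ : bettiCohomology (C ⊗ T) (2 * 2), ofRatClass (ComplexPoints (C ⊗ T)) (2 * 2) γ ∈ algebraicClasses (C ⊗ T) 2 ∧
          corrAction μ hC hT (rfl : 3 + 2 * 2 = 1 + 2 * 3) (ofRatClass (ComplexPoints (C ⊗ T)) (2 * 2) γ) =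
            corrAction μ hC hT (rfl : 3 + 2 * 2 = 1 + 2 * 3) (ofRatClass (ComplexPoints (C ⊗ T)) (2 * 2) (BettiUniverse.crossMap C T (show 1 + 3 = 2 * 2 by norm_num) t)) := by
  have hHCT : HodgeConjectureFor 3 T := hodgeConjectureFor_of_dim_le_three_holds le_rfl hT
  rw [BettiUniverse.hodgeConjectureFor_curve_tensor_iff_forall_exists_corrAction_eq μ hHD hC hT hCT hHCT]
  refine ⟨fun h t ht ↦ h 2 3 3 (by norm_num) rfl le_rfl le_rfl t ht, fun h c j a hj hab hj3 hjn t ht ↦ ?_⟩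
  obtain rfl : j = 3 := by omega
  obtain rfl : c = 2 := by omega
  obtain rfl : a = 3 := by omega
  exact h t ht

/-- **Family form for `C × T`**: `|ι|` rational algebraic classes of `H⁴(C × T)` with ℂ-linearly independent actions `H³(T;ℂ) → H¹(C;ℂ)` and `dim_ℚ Hom_HS(H¹C, H³T(1)) ≤ |ι|` ⇒ `HC(C × T)`.
[cite: VoisinHodgeI2002, §11.3.3 Thm. 11.38–11.40, Lemma 11.41 and pp. 286–287] [cite: Voisin2025, §3.2.1 (12)–(14), Prop. 3.8 and Cor. 3.9] [cite: Deligne2000, §1] -/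
theorem BettiUniverse.hodgeConjectureFor_curve_tensor_threefold_of_linearIndependent_corrAction {ι : Type} [Fintype ι] (hHD : exists_isReal_hodgeModel) (hC : IsSmoothProjective 1 C)
    (hT : IsSmoothProjective 3 T) (hCT : IsSmoothProjective d (C ⊗ T)) (γ : ι → bettiCohomology (C ⊗ T) (2 * 2))
    (hγ : ∀ k, ofRatClass (ComplexPoints (C ⊗ T)) (2 * 2) (γ k) ∈ algebraicClasses (C ⊗ T) 2)
    (hind : LinearIndependent ℂ fun k ↦ corrAction μ hC hT (rfl : 3 + 2 * 2 = 1 + 2 * 3) (ofRatClass (ComplexPoints (C ⊗ T)) (2 * 2) (γ k)))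
    (hHom : Module.finrank ℚ (HodgeStructure.Hom (BettiUniverse.hodge hHD hC 1) (((BettiUniverse.hodge hHD hT 3).tateTwist 1).cast (by norm_num))) ≤ Fintype.card ι) :
    HodgeConjectureFor d (C ⊗ T) := by
  haveI := finite_complexBetti hT 3
  haveI := finite_complexBetti hC 1
  refine (BettiUniverse.hodgeConjectureFor_curve_tensor_threefold_iff_finrank_hom_le_finrank_span μ hHD hC hT hCT).2 (hHom.trans ?_)
  have hsub : Submodule.span ℂ (Set.range fun k ↦ corrAction μ hC hT (rfl : 3 + 2 * 2 = 1 + 2 * 3) (ofRatClass (ComplexPoints (C ⊗ T)) (2 * 2) (γ k))) ≤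
      Submodule.span ℂ ((fun γ ↦ corrAction μ hC hT (rfl : 3 + 2 * 2 = 1 + 2 * 3) (ofRatClass (ComplexPoints (C ⊗ T)) (2 * 2) γ)) ''
        {γ : bettiCohomology (C ⊗ T) (2 * 2) | ofRatClass (ComplexPoints (C ⊗ T)) (2 * 2) γ ∈ algebraicClasses (C ⊗ T) 2}) :=
    Submodule.span_mono (Set.range_subset_iff.2 fun k ↦ ⟨γ k, hγ k, rfl⟩)
  refine le_trans ?_ (Submodule.finrank_mono hsub)
  rw [finrank_span_eq_card hind]

/-- **`C × X` for a smooth projective FOURFOLD `X` satisfying `HC(X)`**: `HC(C × X) ⟺ dim_ℚ Hom_HS(H¹C, H³X(1)) ≤ dim_ℂ ⟨actions H⁵(X;ℂ) → H¹(C;ℂ) of the rational algebraic classes of H⁴(C × X)⟩` (the only odd `j`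
with `3 ≤ j ≤ 4` is `3`). [cite: VoisinHodgeI2002, §11.3.3 Thm. 11.38–11.40, Lemma 11.41 and pp. 286–287] [cite: Voisin2025, §3.2.1 (12)–(14), Prop. 3.8 and Cor. 3.9] [cite: Deligne2000, §1] -/
theorem BettiUniverse.hodgeConjectureFor_curve_tensor_fourfold_iff_finrank_hom_le_finrank_span (hHD : exists_isReal_hodgeModel) (hC : IsSmoothProjective 1 C) (hX : IsSmoothProjective 4 X)
    (hCX : IsSmoothProjective d (C ⊗ X)) (hHCX : HodgeConjectureFor 4 X) :
    HodgeConjectureFor d (C ⊗ X) ↔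
      Module.finrank ℚ (HodgeStructure.Hom (BettiUniverse.hodge hHD hC 1) (((BettiUniverse.hodge hHD hX 3).tateTwist 1).cast (by norm_num))) ≤
        Module.finrank ℂ ↥(Submodule.span ℂ ((fun γ ↦ corrAction μ hC hX (rfl : 5 + 2 * 2 = 1 + 2 * 4) (ofRatClass (ComplexPoints (C ⊗ X)) (2 * 2) γ)) ''
          {γ : bettiCohomology (C ⊗ X) (2 * 2) | ofRatClass (ComplexPoints (C ⊗ X)) (2 * 2) γ ∈ algebraicClasses (C ⊗ X) 2})) := by
  have e := BettiUniverse.finrank_hodgeClasses_tensor_hodge_eq_finrank_hom_tateTwist hHD hC hX 1 3 (s := 1) (by norm_num)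
  rw [show (((1 : ℕ) : ℤ) + 1) = ((2 : ℕ) : ℤ) by norm_num] at e
  rw [← e, BettiUniverse.hodgeConjectureFor_curve_tensor_iff_forall_finrank_le μ hHD hC hX hCX hHCX]
  refine ⟨fun h ↦ h 2 3 5 (by norm_num) rfl le_rfl (by norm_num), fun h c j a hj hab hj3 hjn ↦ ?_⟩
  rcases (show j = 3 ∨ j = 4 by omega) with rfl | rfl
  · obtain rfl : c = 2 := by omega
    obtain rfl : a = 5 := by omega
    exact h
  · exfalso
    omega

end Pieces

end Literature.AlgebraicGeometry.HodgeTheory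

end
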